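import Summits.Ventures.PercRepro.Night2LocalD3TwoTwoA

/-!
# PercRepro — the cell `(a, k) = (2, 2)` at `|E ∖ G| = 3`, `q = 4`: the column bound (night-2, gen 13)

At a far set `S` with `coloops S = K` (`proofs/NIGHT-2-dq3.md` §5.3): `S` has no layer-1 preimage (`L1_eq_zero_of_coloops_eq_K`),
so `cap₂(S) = capS(S) ≥ 2/5`; with a member carrying weight, `|S| = 6` and the members carrying weight are pair members
`S ∖ {u, u'}` with `{u, u'} ⊆ G ∖ cl(S ∖ {u, u'})` (`not_mem_clF_of_pair`).  The layer-1 request of any covering set is a sum over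
the three deletions `S'' ∖ t`, `t ∈ S'' ∖ K` (`L1_le_sum_erase`).

* no fat pair member: every request is `≤ 1/5`, so `L₁ ≤ 3/5` at every covering set, every loss is `≤ req/3 ≤ 1/15`, every
  `w₂ ≤ 1/15`, and `#ex2 ≤ 6` gives `load₂ ≤ 2/5`;
* a fat pair member `F` (`G ∖ S ⊆ cl F`, unique by `not_two_fat_pairs`): `L₁ ≤ 6/25 + 2/5` everywhere (loss fraction `≤ 3/8`), and
  at the covering sets `S ∖ v` with `v ∈ F ∖ K` the deletion `K ∪ (S ∖ F)` is no member, so `L₁ ≤ 2/5` and nothing is lost there;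
  hence `w₂(F) ≤ 18/100`, every other `w₂ ≤ 3/80`, `load₂ ≤ 18/100 + 5 · 3/80 < 2/5`.

**`load2_le_cap2_two_two`**: every far set with two coloops satisfies `load₂(S) ≤ cap₂(S)`.
-/

open scoped Matroid

namespace PercRepro.Shadow

open Finset PerFlat ThmH

variable {α : Type*} [DecidableEq α] {M : Matroid α} [M.Finite]

section TwoTwoB

variable {G S : Finset α}

open scoped Classical in
/-- **A far set whose coloops are exactly `K` has no layer-1 preimage.** -/
theorem L1_eq_zero_of_coloops_eq_K (hG : G ∈ flatsQ M (4 + 1)) (hd : (gr M \ G).card = 3)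
    (hS : S ∈ shadowAt M (4 + 2) 4 (Uq M (4 + 2) 4) G)
    (hcol : coloops M S = G.filter (fun y => y ∉ clF M (G.erase y))) : L1 M 4 G S = 0 := by
  unfold L1
  apply Finset.sum_eq_zero
  intro B' hB'
  exfalso
  rw [Finset.mem_filter, mem_coverPreimages, mem_coverSets] at hB'
  obtain ⟨⟨hB'm, z, hz, hzS⟩, hB'0⟩ := hB'
  have hB'U : B' ∈ Uq M (4 + 2) 4 := (mem_membersIn.1 hB'm).1
  have hzB' : z ∉ B' := fun h => (Finset.mem_sdiff.1 hz).2 (subset_clF hB'U h)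
  have hB'eq : B' = S.erase z := by rw [← hzS, Finset.erase_insert hzB']
  have hzcol : z ∈ coloops M S := by
    rw [mem_coloops]
    refine ⟨by rw [← hzS]; exact Finset.mem_insert_self _ _, ?_⟩
    rw [← hB'eq]
    exact (Finset.mem_sdiff.1 hz).2
  rw [hcol] at hzcol
  apply hB'0
  rw [hB'eq]
  exact mem_lay0_of_erase_mem_K hG hd hS hzcol (hB'eq ▸ hB'm)

/-- `cap₂(S) ≥ 2/5` at a far set with `coloops S = K`. -/
theorem two_fifths_le_cap2_of_coloops_eq_K (hG : G ∈ flatsQ M (4 + 1)) (hd : (gr M \ G).card = 3)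
    (hk : kColoops M G = 2) (hS : S ∈ shadowAt M (4 + 2) 4 (Uq M (4 + 2) 4) G)
    (hcol : coloops M S = G.filter (fun y => y ∉ clF M (G.erase y))) : 2 / 5 ≤ cap2 M 4 G S := by
  have hcap := two_fifths_le_capS hd hk (subset_of_mem_shadowAt hS)
  have h1 := cap2_ge_capS_sub_L1 (M := M) (q := 4) (G := G) (S := S) (by linarith)
  rw [L1_eq_zero_of_coloops_eq_K hG hd hS hcol] at h1
  linarith

/-- For a pair `S ∖ B = {u, u'}` avoiding `K`, `S ∖ u' = insert u B`. -/
theorem erase_eq_insert_of_sdiff_pair {B : Finset α} (hBS : B ⊆ S) {u u' : α} (hP : S \ B = {u, u'}) (huu' : u ≠ u') :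
    S.erase u' = insert u B := by
  have hu : u ∈ S \ B := by rw [hP]; exact Finset.mem_insert_self _ _
  have hu' : u' ∈ S \ B := by rw [hP]; exact Finset.mem_insert_of_mem (Finset.mem_singleton_self _)
  ext e
  rw [Finset.mem_erase, Finset.mem_insert]
  constructor
  · rintro ⟨heu', heS⟩
    by_cases heB : e ∈ B
    · exact Or.inr heB
    · left
      have : e ∈ S \ B := Finset.mem_sdiff.2 ⟨heS, heB⟩
      rw [hP, Finset.mem_insert, Finset.mem_singleton] at this
      rcases this with h | h
      · exact h
      · exact absurd h heu'
  · rintro (rfl | heB)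
    · exact ⟨huu', (Finset.mem_sdiff.1 hu).1⟩
    · exact ⟨fun h => (Finset.mem_sdiff.1 hu').2 (h ▸ heB), hBS heB⟩

open scoped Classical in
/-- **The quadrangle property**: at `|S| = 6` with `coloops S = K`, a set `B` with `K ⊆ B ⊆ S`, `|S ∖ B| = 2` and `ρ(B) ≤ 4` has
both points of `S ∖ B` outside `cl B` (`S ∖ u'` is independent of size `5`). -/
theorem not_mem_clF_of_pair (hG : G ∈ flatsQ M (4 + 1)) (hS : S ∈ shadowAt M (4 + 2) 4 (Uq M (4 + 2) 4) G)
    (hS6 : S.card = 6) (hcol : coloops M S = G.filter (fun y => y ∉ clF M (G.erase y))) {B : Finset α}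
    (hKB : G.filter (fun y => y ∉ clF M (G.erase y)) ⊆ B) (hBS : B ⊆ S) (hcard : (S \ B).card = 2)
    (hrB : rkN M B ≤ 4) {u : α} (hu : u ∈ S \ B) : u ∉ clF M B := by
  intro hucl
  obtain ⟨a, b, hab, hP⟩ := Finset.card_eq_two.1 hcard
  have hSg : S ⊆ gr M := (subset_of_mem_shadowAt hS).trans (mem_flatsQ.1 hG).1
  -- the other point `u'` of the pair
  have hu' : ∃ u', u' ≠ u ∧ S \ B = {u, u'} := by
    rw [hP, Finset.mem_insert, Finset.mem_singleton] at hu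
    rcases hu with rfl | rfl
    · exact ⟨b, hab.symm, hP⟩
    · exact ⟨a, hab, by rw [hP, Finset.pair_comm]⟩
  obtain ⟨u', hu'u, hP'⟩ := hu'
  have hu'S : u' ∈ S \ B := by rw [hP']; exact Finset.mem_insert_of_mem (Finset.mem_singleton_self _)
  have hu'c : u' ∉ coloops M S := fun h => (Finset.mem_sdiff.1 hu'S).2 (hKB (hcol ▸ h))
  have hI : M.Indep ((S.erase u' : Finset α) : Set α) :=
    indep_erase_of_not_coloop hG hS hS6 (Finset.mem_sdiff.1 hu'S).1 hu'c
  have hr5 : rkN M (S.erase u') = 5 := by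
    rw [rkN_eq_card_of_indep hI, Finset.card_erase_of_mem (Finset.mem_sdiff.1 hu'S).1, hS6]
  have hsub : S.erase u' ⊆ clF M B := by
    rw [erase_eq_insert_of_sdiff_pair hBS hP' (Ne.symm hu'u)]
    exact Finset.insert_subset hucl (subset_clF_of_subset_gr (hBS.trans hSg))
  have h1 := rkN_mono (M := M) hsub
  rw [rkN_clF, hr5] at h1
  omega

open scoped Classical in
/-- **The layer-1 request of a shadow set is a sum over its deletions outside `K`**:
`L₁(S'') ≤ Σ_{t ∈ S'' ∖ K} [S'' ∖ t ∈ membersIn] · req(S'' ∖ t)`. -/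
theorem L1_le_sum_erase (hG : G ∈ flatsQ M (4 + 1)) (hd : (gr M \ G).card = 3) {S'' : Finset α}
    (hS'' : S'' ∈ shadowAt M (4 + 2) 4 (Uq M (4 + 2) 4) G) :
    L1 M 4 G S'' ≤ ∑ t ∈ S'' \ G.filter (fun y => y ∉ clF M (G.erase y)),
      (if S''.erase t ∈ membersIn M (Uq M (4 + 2) 4) G then req M 4 (S''.erase t) else 0) := by
  set K := G.filter (fun y => y ∉ clF M (G.erase y)) with hKdef
  set F := (coverPreimages M (Uq M (4 + 2) 4) G S'').filter (fun B => B ∉ lay0 M 4 G) with hFdef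
  have key : ∀ B ∈ F, ∃ z ∈ S'' \ K, B = S''.erase z := by
    intro B hB
    rw [hFdef, Finset.mem_filter, mem_coverPreimages, mem_coverSets] at hB
    obtain ⟨⟨hBm, z, hz, hzS⟩, hB0⟩ := hB
    have hBU : B ∈ Uq M (4 + 2) 4 := (mem_membersIn.1 hBm).1
    have hzB : z ∉ B := fun h => (Finset.mem_sdiff.1 hz).2 (subset_clF hBU h)
    have hBeq : B = S''.erase z := by rw [← hzS, Finset.erase_insert hzB]
    refine ⟨z, Finset.mem_sdiff.2 ⟨by rw [← hzS]; exact Finset.mem_insert_self _ _, ?_⟩, hBeq⟩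
    intro hzK
    apply hB0
    rw [hBeq]
    exact mem_lay0_of_erase_mem_K hG hd hS'' hzK (hBeq ▸ hBm)
  have hFsub : F ⊆ (S'' \ K).image (fun t => S''.erase t) := by
    intro B hB
    obtain ⟨z, hz, rfl⟩ := key B hB
    exact Finset.mem_image.2 ⟨z, hz, rfl⟩
  have hmem : ∀ B ∈ F, B ∈ membersIn M (Uq M (4 + 2) 4) G := by
    intro B hB
    rw [hFdef, Finset.mem_filter, mem_coverPreimages] at hB
    exact hB.1.1
  have hinj : Set.InjOn (fun t => S''.erase t) ((S'' \ K : Finset α) : Set α) :=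
    (Finset.erase_injOn S'').mono (by intro t ht; exact Finset.mem_coe.2 (Finset.mem_sdiff.1 (Finset.mem_coe.1 ht)).1)
  have hsum : L1 M 4 G S'' = ∑ t ∈ S'' \ K, (if S''.erase t ∈ F then req M 4 (S''.erase t) else 0) := by
    unfold L1
    rw [← hFdef]
    calc ∑ B ∈ F, req M 4 B = ∑ B ∈ (S'' \ K).image (fun t => S''.erase t) ∩ F, req M 4 B := by
          rw [Finset.inter_eq_right.2 hFsub]
      _ = ∑ B ∈ (S'' \ K).image (fun t => S''.erase t), (if B ∈ F then req M 4 B else 0) :=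
          (Finset.sum_ite_mem _ _ _).symm
      _ = _ := Finset.sum_image (fun x hx y hy h => hinj (Finset.mem_coe.2 hx) (Finset.mem_coe.2 hy) h)
  rw [hsum]
  apply Finset.sum_le_sum
  intro t _
  split_ifs with h1 h2 h2
  · exact le_refl _
  · exact absurd (hmem _ h1) h2
  · exact req_nonneg 4 _
  · exact le_refl _

/-- A pair member's request is at most `6/25`; a pair member missing a point of `G ∖ S` in its closure requests at most `1/5`. -/
theorem req_pair_le (hG : G ∈ flatsQ M (4 + 1)) (hd : (gr M \ G).card = 3)
    (hS : S ∈ shadowAt M (4 + 2) 4 (Uq M (4 + 2) 4) G) (hS6 : S.card = 6)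
    (hcol : coloops M S = G.filter (fun y => y ∉ clF M (G.erase y))) {B : Finset α}
    (hBm : B ∈ membersIn M (Uq M (4 + 2) 4) G) (hKB : G.filter (fun y => y ∉ clF M (G.erase y)) ⊆ B) (hBS : B ⊆ S)
    (hcard : (S \ B).card = 2) :
    req M 4 B ≤ 6 / 25 ∧ (¬ (G \ S ⊆ clF M B) → req M 4 B ≤ 1 / 5) ∧ 2 ≤ (G \ clF M B).card ∧
      (¬ (G \ S ⊆ clF M B) → 3 ≤ (G \ clF M B).card) := by
  have hSG : S ⊆ G := subset_of_mem_shadowAt hS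
  have hBU : B ∈ Uq M (4 + 2) 4 := (mem_membersIn.1 hBm).1
  have hrB : rkN M B ≤ 4 := by
    have h := (mem_Uq.1 hBU).2.1
    rw [eRk_eq_rkN] at h
    have : rkN M B = 4 := by exact_mod_cast h
    omega
  have hsub : S \ B ⊆ G \ clF M B := fun u hu =>
    Finset.mem_sdiff.2 ⟨hSG (Finset.mem_sdiff.1 hu).1, not_mem_clF_of_pair hG hS hS6 hcol hKB hBS hcard hrB hu⟩
  have h2 : 2 ≤ (G \ clF M B).card := hcard ▸ Finset.card_le_card hsub
  have h3 : ¬ (G \ S ⊆ clF M B) → 3 ≤ (G \ clF M B).card := by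
    intro hnot
    rw [Finset.not_subset] at hnot
    obtain ⟨p, hpP, hpcl⟩ := hnot
    have hsub' : insert p (S \ B) ⊆ G \ clF M B :=
      Finset.insert_subset (Finset.mem_sdiff.2 ⟨(Finset.mem_sdiff.1 hpP).1, hpcl⟩) hsub
    have := Finset.card_le_card hsub'
    rw [Finset.card_insert_of_notMem (fun h => (Finset.mem_sdiff.1 hpP).2 (Finset.mem_sdiff.1 h).1), hcard] at this
    exact this
  refine ⟨?_, ?_, h2, h3⟩
  · have := req_le_of_le_card hG hd (mem_membersIn.1 hBm).2 h2
    norm_num at this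
    exact this
  · intro hnot
    have := req_le_of_le_card hG hd (mem_membersIn.1 hBm).2 (h3 hnot)
    norm_num at this
    exact this

open scoped Classical in
/-- The deletions `(S ∖ v) ∖ t` (`v, t ∈ S ∖ K` distinct) are pair-shaped: `K ⊆ (S ∖ v) ∖ t ⊆ S` with complement `{v, t}`. -/
theorem pair_shape_of_erase_erase (hcol : coloops M S = G.filter (fun y => y ∉ clF M (G.erase y))) {v t : α}
    (hv : v ∈ S \ G.filter (fun y => y ∉ clF M (G.erase y))) (ht : t ∈ (S.erase v) \ G.filter (fun y => y ∉ clF M (G.erase y))) :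
    G.filter (fun y => y ∉ clF M (G.erase y)) ⊆ (S.erase v).erase t ∧ (S.erase v).erase t ⊆ S ∧
      (S \ (S.erase v).erase t).card = 2 := by
  have hvS : v ∈ S := (Finset.mem_sdiff.1 hv).1
  have hvK : v ∉ G.filter (fun y => y ∉ clF M (G.erase y)) := (Finset.mem_sdiff.1 hv).2
  have htS : t ∈ S := (Finset.mem_erase.1 (Finset.mem_sdiff.1 ht).1).2
  have htv : t ≠ v := (Finset.mem_erase.1 (Finset.mem_sdiff.1 ht).1).1
  have htK : t ∉ G.filter (fun y => y ∉ clF M (G.erase y)) := (Finset.mem_sdiff.1 ht).2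
  refine ⟨?_, (Finset.erase_subset _ _).trans (Finset.erase_subset _ _), ?_⟩
  · intro e he
    have heS : e ∈ S := coloops_subset_self S (hcol ▸ he)
    rw [Finset.mem_erase, Finset.mem_erase]
    exact ⟨fun h => htK (h ▸ he), fun h => hvK (h ▸ he), heS⟩
  · have : S \ (S.erase v).erase t = {v, t} := by
      ext e
      rw [Finset.mem_sdiff, Finset.mem_erase, Finset.mem_erase, Finset.mem_insert, Finset.mem_singleton]
      constructor
      · rintro ⟨heS, h⟩
        by_cases hev : e = v
        · exact Or.inl hev
        · right
          by_contra het
          exact h ⟨het, hev, heS⟩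
      · rintro (rfl | rfl)
        · exact ⟨hvS, fun h => h.2.1 rfl⟩
        · exact ⟨htS, fun h => h.1 rfl⟩
    rw [this, Finset.card_pair (Ne.symm htv)]

end TwoTwoB

end PercRepro.Shadow
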